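import Summits.AtomisticToContinuum.FouriersLaw.Theses.BondHeatUncertainty
import Summits.AtomisticToContinuum.FouriersLaw.Theorems.ExtensiveSnapshotIrreversibility.Negative.DegenerateInstances

/-!
# `ExtensiveSnapshotIrreversibility` — the tilted (log-density) criterion for the snapshot
divergence (structural lemmas, cdisprove cycle 2)

Support file for crux item `stmt-AtomisticToContinuum-9121` (route `BondHeatUncertainty`, decl
`ExtensiveSnapshotIrreversibility`: `KL(μ_{N,T+δ/2,T-δ/2} ‖ Θ_*μ) ≤ C·N·δ²` eventually in `δ`).
Write the steady state as an exponential tilt `μ = μ₀.tilted φ` of a flip-invariant probability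
measure `μ₀` (for the chain: the Gibbs state at the mean temperature, flip-invariant by
`gibbsMeasure_map_flip`; `φ = log dμ_δ/dμ_T`, the McLennan form).  Then, with `Θ(q,p) = (q,-p)`
and `d := φ - φ∘Θ` (twice the odd part of the log-density):

* `map_flip_tilted`: `Θ_*(μ₀.tilted φ) = μ₀.tilted (φ∘Θ)` (same normalising constant);
* `llr_tilted_flip`: the log-likelihood ratio of `μ` against its flip is `d`, a.e.;
* `klDiv_flip_tilted_ne_top_iff`: **exact finiteness criterion** `KL(μ ‖ Θ_*μ) < ∞ ↔ d ∈ L¹(μ)`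
  — this is precisely the fixed-`N` debt of the crux ("log-ratio integrability"): a fixed-`N`
  counterexample must be a steady state whose odd log-density is NOT integrable under itself;
* `toReal_klDiv_flip_tilted`: `KL(μ ‖ Θ_*μ) = ∫ d dμ`;
* `klDiv_flip_tilted_le_integral_sq`: **`KL(μ ‖ Θ_*μ) ≤ ∫ d² dμ`** (from
  `(a-b)(e^a-e^b) ≤ (a-b)²(e^a+e^b)` and flip-invariance of `μ₀`; the sharp small-`d` constant
  would be `½`).  Hence the `N`-uniform content of the crux is implied by an `L²(μ_δ)` bound
  `∫ (φ_δ - φ_δ∘Θ)² dμ_δ ≤ C·N·δ²` on the odd part of the NESS log-density — no second-order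
  expansion in `δ`, no limit, no density lower bound beyond positivity is needed for the UPPER
  bound the crux asks;
* `klDiv_flip_gibbs_tilted_le`: the specialisation to the Gibbs state of the pinned chain.

None of these asserts the crux; the composition with the crux's quantifiers is in the crux work
file (`Cruxes/…/Disproof.lean`, `crux_of_oddLogDensityBound`).
-/

namespace Summit.AtomisticToContinuum.FouriersLaw.Theorems.ExtensiveSnapshotIrreversibility.Negative

open MeasureTheory Filter Topology InformationTheory Real
open scoped ENNReal
open Literature.MathematicalPhysics.KineticTheory.HeatConduction

variable {N : ℕ}

/-- pointwise: `(a - b)(e^a - e^b) ≤ (a - b)²(e^a + e^b)`. [folklore] -/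
theorem sub_mul_exp_sub_exp_le (a b : ℝ) :
    (a - b) * (exp a - exp b) ≤ (a - b) ^ 2 * (exp a + exp b) := by
  have ha := exp_pos a
  have hb := exp_pos b
  rcases le_total b a with h | h
  · -- `e^a - e^b ≤ (a - b) e^a`
    have h1 : exp a - exp b ≤ (a - b) * exp a := by
      have := add_one_le_exp (b - a)
      have h2 : exp b = exp a * exp (b - a) := by rw [← exp_add]; ring_nf
      nlinarith [mul_le_mul_of_nonneg_left this ha.le]
    have h3 : 0 ≤ a - b := sub_nonneg.2 h
    nlinarith [mul_le_mul_of_nonneg_left h1 h3, sq_nonneg (a - b),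
      mul_nonneg (sq_nonneg (a-b)) hb.le]
  · have h1 : exp b - exp a ≤ (b - a) * exp b := by
      have := add_one_le_exp (a - b)
      have h2 : exp a = exp b * exp (a - b) := by rw [← exp_add]; ring_nf
      nlinarith [mul_le_mul_of_nonneg_left this hb.le]
    have h3 : 0 ≤ b - a := sub_nonneg.2 h
    nlinarith [mul_le_mul_of_nonneg_left h1 h3, sq_nonneg (a - b),
      mul_nonneg (sq_nonneg (a-b)) ha.le]

variable (μ₀ : Measure (PhaseSpace N))

/-- invariance of integrals under the flip for a flip-invariant measure [folklore] -/
theorem integral_comp_flip {E : Type*} [NormedAddCommGroup E] [NormedSpace ℝ E]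
    (hinv : μ₀.map (fun x : PhaseSpace N => (x.1, -x.2)) = μ₀) (G : PhaseSpace N → E) :
    ∫ x, G (x.1, -x.2) ∂μ₀ = ∫ x, G x ∂μ₀ := by
  have h := integral_map_equiv (momentumReversal N) G (μ := μ₀)
  have hinv' : Measure.map (momentumReversal N) μ₀ = μ₀ := hinv
  rw [hinv'] at h
  rw [h]
  rfl

/-- Integrability is invariant under the flip for a flip-invariant measure. [folklore] -/
theorem integrable_comp_flip_iff {E : Type*} [NormedAddCommGroup E]
    (hinv : μ₀.map (fun x : PhaseSpace N => (x.1, -x.2)) = μ₀) (G : PhaseSpace N → E) :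
    Integrable (fun x => G (x.1, -x.2)) μ₀ ↔ Integrable G μ₀ := by
  have h := integrable_map_equiv (momentumReversal N) G (μ := μ₀)
  have hinv' : Measure.map (momentumReversal N) μ₀ = μ₀ := hinv
  rw [hinv'] at h
  exact h.symm

/-- the normalising constants of `φ` and `φ ∘ Θ` agree [folklore] -/
theorem integral_exp_comp_flip (hinv : μ₀.map (fun x : PhaseSpace N => (x.1, -x.2)) = μ₀)
    (φ : PhaseSpace N → ℝ) :
    ∫ x, exp (φ (x.1, -x.2)) ∂μ₀ = ∫ x, exp (φ x) ∂μ₀ :=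
  integral_comp_flip μ₀ hinv (fun x => exp (φ x))

/-- **The flip of a tilted flip-invariant measure is the tilt by the flipped potential.**
[folklore] -/
theorem map_flip_tilted (hinv : μ₀.map (fun x : PhaseSpace N => (x.1, -x.2)) = μ₀)
    {φ : PhaseSpace N → ℝ} (hφm : Measurable φ) :
    (μ₀.tilted φ).map (fun x : PhaseSpace N => (x.1, -x.2)) =
      μ₀.tilted (fun x => φ (x.1, -x.2)) := by
  have hm : Measurable (fun x : PhaseSpace N => (x.1, -x.2)) := (momentumReversal N).measurable
  ext s hs
  rw [Measure.map_apply hm hs, tilted_apply' _ _ (hm hs), tilted_apply' _ _ hs,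
    integral_exp_comp_flip μ₀ hinv φ]
  set Z := ∫ x, exp (φ x) ∂μ₀
  have hf : Measurable fun a : PhaseSpace N => ENNReal.ofReal (exp (φ (a.1, -a.2)) / Z) :=
    ((hφm.comp hm).exp.div_const Z).ennreal_ofReal
  -- rewrite μ₀ as the push-forward of itself on the right-hand side
  have h1 : ∫⁻ a in s, ENNReal.ofReal (exp (φ (a.1, -a.2)) / Z) ∂μ₀ =
      ∫⁻ a in s, ENNReal.ofReal (exp (φ (a.1, -a.2)) / Z)
        ∂(μ₀.map (fun x : PhaseSpace N => (x.1, -x.2))) := by rw [hinv]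
  rw [h1, setLIntegral_map hs hf hm]
  refine setLIntegral_congr_fun (hm hs) (fun x _ => ?_)
  simp

variable {μ₀}

/-- a.e. log-likelihood ratio between the tilt and its flip: `φ - φ ∘ Θ` [folklore] -/
theorem llr_tilted_flip [IsProbabilityMeasure μ₀]
    (hinv : μ₀.map (fun x : PhaseSpace N => (x.1, -x.2)) = μ₀)
    {φ : PhaseSpace N → ℝ} (hφm : Measurable φ) (hexp : Integrable (fun x => exp (φ x)) μ₀) :
    llr (μ₀.tilted φ) (μ₀.tilted (fun x => φ (x.1, -x.2))) =ᵐ[μ₀]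
      fun x => φ x - φ (x.1, -x.2) := by
  have hexp' : Integrable (fun x => exp (φ (x.1, -x.2))) μ₀ :=
    (integrable_comp_flip_iff μ₀ hinv (fun x => exp (φ x))).2 hexp
  have hac : μ₀ ≪ μ₀.tilted (fun x => φ (x.1, -x.2)) := absolutelyContinuous_tilted hexp'
  have h1 := llr_tilted_left (μ := μ₀) (ν := μ₀.tilted (fun x => φ (x.1, -x.2))) (f := φ) hac
    hexp hφm.aemeasurable
  have h2 := llr_tilted_right (μ := μ₀) (ν := μ₀) (f := fun x => φ (x.1, -x.2))
    (Measure.AbsolutelyContinuous.rfl) hexp'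
  have h3 := llr_self μ₀
  filter_upwards [h1, h2, h3] with x hx1 hx2 hx3
  rw [hx1, hx2, hx3, integral_exp_comp_flip μ₀ hinv φ]
  simp only [Pi.zero_apply]
  ring

/-- **Finiteness criterion.** For `μ = μ₀.tilted φ` with `μ₀` a flip-invariant probability
measure: `KL(μ ‖ Θ_*μ) < ∞ ↔ φ - φ∘Θ ∈ L¹(μ)`. [folklore] -/
theorem klDiv_flip_tilted_ne_top_iff [IsProbabilityMeasure μ₀]
    (hinv : μ₀.map (fun x : PhaseSpace N => (x.1, -x.2)) = μ₀)
    {φ : PhaseSpace N → ℝ} (hφm : Measurable φ) (hexp : Integrable (fun x => exp (φ x)) μ₀) :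
    klDiv (μ₀.tilted φ) ((μ₀.tilted φ).map (fun x : PhaseSpace N => (x.1, -x.2))) ≠ ∞ ↔
      Integrable (fun x => φ x - φ (x.1, -x.2)) (μ₀.tilted φ) := by
  have hexp' : Integrable (fun x => exp (φ (x.1, -x.2))) μ₀ :=
    (integrable_comp_flip_iff μ₀ hinv (fun x => exp (φ x))).2 hexp
  rw [map_flip_tilted μ₀ hinv hφm, klDiv_ne_top_iff]
  have hac : μ₀.tilted φ ≪ μ₀.tilted (fun x => φ (x.1, -x.2)) :=
    (tilted_absolutelyContinuous μ₀ φ).trans (absolutelyContinuous_tilted hexp')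
  have hae := (tilted_absolutelyContinuous μ₀ φ).ae_le (llr_tilted_flip hinv hφm hexp)
  rw [integrable_congr hae]
  exact ⟨fun h => h.2, fun h => ⟨hac, h⟩⟩

/-- **Value.** `KL(μ ‖ Θ_*μ) = ∫ (φ - φ∘Θ) dμ` (as `toReal`; both sides `0`-junk together).
[folklore] -/
theorem toReal_klDiv_flip_tilted [IsProbabilityMeasure μ₀]
    (hinv : μ₀.map (fun x : PhaseSpace N => (x.1, -x.2)) = μ₀)
    {φ : PhaseSpace N → ℝ} (hφm : Measurable φ) (hexp : Integrable (fun x => exp (φ x)) μ₀) :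
    (klDiv (μ₀.tilted φ) ((μ₀.tilted φ).map (fun x : PhaseSpace N => (x.1, -x.2)))).toReal =
      ∫ x, (φ x - φ (x.1, -x.2)) ∂(μ₀.tilted φ) := by
  have hexp' : Integrable (fun x => exp (φ (x.1, -x.2))) μ₀ :=
    (integrable_comp_flip_iff μ₀ hinv (fun x => exp (φ x))).2 hexp
  haveI : IsProbabilityMeasure (μ₀.tilted φ) := isProbabilityMeasure_tilted hexp
  haveI : IsProbabilityMeasure (μ₀.tilted (fun x => φ (x.1, -x.2))) :=
    isProbabilityMeasure_tilted hexp'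
  rw [map_flip_tilted μ₀ hinv hφm]
  have hac : μ₀.tilted φ ≪ μ₀.tilted (fun x => φ (x.1, -x.2)) :=
    (tilted_absolutelyContinuous μ₀ φ).trans (absolutelyContinuous_tilted hexp')
  rw [toReal_klDiv_of_measure_eq hac (by simp)]
  exact integral_congr_ae ((tilted_absolutelyContinuous μ₀ φ).ae_le (llr_tilted_flip hinv hφm hexp))

/-- **Snapshot KL is dominated by the second moment of the odd part of the log-density.**
For `μ = μ₀.tilted φ`, `μ₀` a flip-invariant probability measure, and `d := φ - φ∘Θ`:
if `d ∈ L²(μ)` then `KL(μ ‖ Θ_*μ) ≤ ∫ d² dμ` (and in particular is finite). [folklore] -/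
theorem klDiv_flip_tilted_le_integral_sq [IsProbabilityMeasure μ₀]
    (hinv : μ₀.map (fun x : PhaseSpace N => (x.1, -x.2)) = μ₀)
    {φ : PhaseSpace N → ℝ} (hφm : Measurable φ) (hexp : Integrable (fun x => exp (φ x)) μ₀)
    (h2 : Integrable (fun x => (φ x - φ (x.1, -x.2)) ^ 2) (μ₀.tilted φ)) :
    klDiv (μ₀.tilted φ) ((μ₀.tilted φ).map (fun x : PhaseSpace N => (x.1, -x.2))) ≤
      ENNReal.ofReal (∫ x, (φ x - φ (x.1, -x.2)) ^ 2 ∂(μ₀.tilted φ)) := by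
  set d : PhaseSpace N → ℝ := fun x => φ x - φ (x.1, -x.2) with hd
  have hdm : Measurable d := hφm.sub (hφm.comp (momentumReversal N).measurable)
  have hdodd : ∀ x : PhaseSpace N, d (x.1, -x.2) = -d x := fun x => by
    simp [hd]
  -- `d ∈ L¹(μ)` from `d ∈ L²(μ)` (probability space): `|d| ≤ 1 + d²`
  haveI : IsProbabilityMeasure (μ₀.tilted φ) := isProbabilityMeasure_tilted hexp
  have h1 : Integrable d (μ₀.tilted φ) := by
    refine Integrable.mono' ((integrable_const (1 : ℝ)).add h2) hdm.aestronglyMeasurable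
      (ae_of_all _ fun x => ?_)
    rw [Real.norm_eq_abs]
    change |d x| ≤ 1 + (d x) ^ 2
    rcases le_total |d x| 1 with h | h
    · linarith [sq_nonneg (d x)]
    · have : |d x| ≤ |d x| ^ 2 := by nlinarith
      rw [sq_abs] at this; linarith
  -- finiteness, and the value as an integral
  have hfin : klDiv (μ₀.tilted φ) ((μ₀.tilted φ).map (fun x : PhaseSpace N => (x.1, -x.2))) ≠ ∞ :=
    (klDiv_flip_tilted_ne_top_iff hinv hφm hexp).2 h1
  rw [← ENNReal.ofReal_toReal hfin, toReal_klDiv_flip_tilted hinv hφm hexp]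
  refine ENNReal.ofReal_le_ofReal ?_
  -- reduce to weighted `μ₀`-integrals
  set Z := ∫ x, exp (φ x) ∂μ₀ with hZ
  have hZpos : 0 < Z := integral_exp_pos hexp
  have hw1 : Integrable (fun x => exp (φ x) * d x) μ₀ := by
    have := (integrable_tilted_iff hexp d).1 h1; simpa [smul_eq_mul] using this
  have hw2 : Integrable (fun x => exp (φ x) * d x ^ 2) μ₀ := by
    have := (integrable_tilted_iff hexp (fun x => d x ^ 2)).1 h2; simpa [smul_eq_mul] using this
  -- flipped weights, by invariance
  have hw1' : Integrable (fun x => exp (φ (x.1, -x.2)) * d x) μ₀ := by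
    have h := (integrable_comp_flip_iff μ₀ hinv (fun x => -(exp (φ x) * d x))).2 hw1.neg
    refine h.congr (ae_of_all _ fun x => ?_)
    simp only [hdodd x]; ring
  have hw2' : Integrable (fun x => exp (φ (x.1, -x.2)) * d x ^ 2) μ₀ := by
    have h := (integrable_comp_flip_iff μ₀ hinv (fun x => exp (φ x) * d x ^ 2)).2 hw2
    refine h.congr (ae_of_all _ fun x => ?_)
    simp only [hdodd x]; ring
  have hI1 : ∫ x, exp (φ (x.1, -x.2)) * d x ∂μ₀ = -∫ x, exp (φ x) * d x ∂μ₀ := by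
    rw [← integral_neg, ← integral_comp_flip μ₀ hinv (fun x => -(exp (φ x) * d x))]
    refine integral_congr_ae (ae_of_all _ fun x => ?_)
    simp only [hdodd x]; ring
  have hI2 : ∫ x, exp (φ (x.1, -x.2)) * d x ^ 2 ∂μ₀ = ∫ x, exp (φ x) * d x ^ 2 ∂μ₀ := by
    rw [← integral_comp_flip μ₀ hinv (fun x => exp (φ x) * d x ^ 2)]
    refine integral_congr_ae (ae_of_all _ fun x => ?_)
    simp only [hdodd x]; ring
  -- pointwise inequality `d (e^φ - e^{φΘ}) ≤ d² (e^φ + e^{φΘ})`, integrated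
  have hpt : ∀ x, exp (φ x) * d x - exp (φ (x.1, -x.2)) * d x ≤
      exp (φ x) * d x ^ 2 + exp (φ (x.1, -x.2)) * d x ^ 2 := fun x => by
    have := sub_mul_exp_sub_exp_le (φ x) (φ (x.1, -x.2))
    simp only [hd] at this ⊢
    nlinarith [this]
  have hint : ∫ x, (exp (φ x) * d x - exp (φ (x.1, -x.2)) * d x) ∂μ₀ ≤
      ∫ x, (exp (φ x) * d x ^ 2 + exp (φ (x.1, -x.2)) * d x ^ 2) ∂μ₀ :=
    integral_mono (hw1.sub hw1') (hw2.add hw2') hpt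
  rw [integral_sub hw1 hw1', integral_add hw2 hw2', hI1, hI2] at hint
  -- so `∫ e^φ d ≤ ∫ e^φ d²` w.r.t. `μ₀`; divide by `Z`
  have hkey : ∫ x, exp (φ x) * d x ∂μ₀ ≤ ∫ x, exp (φ x) * d x ^ 2 ∂μ₀ := by linarith
  rw [integral_tilted, integral_tilted]
  simp only [smul_eq_mul]
  have e1 : ∫ x, exp (φ x) / Z * d x ∂μ₀ = Z⁻¹ * ∫ x, exp (φ x) * d x ∂μ₀ := by
    rw [← integral_const_mul]; refine integral_congr_ae (ae_of_all _ fun x => ?_); ring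
  have e2 : ∫ x, exp (φ x) / Z * d x ^ 2 ∂μ₀ = Z⁻¹ * ∫ x, exp (φ x) * d x ^ 2 ∂μ₀ := by
    rw [← integral_const_mul]; refine integral_congr_ae (ae_of_all _ fun x => ?_); ring
  change ∫ x, exp (φ x) / Z * d x ∂μ₀ ≤ ∫ x, exp (φ x) / Z * (d x) ^ 2 ∂μ₀
  rw [e1, e2]
  exact mul_le_mul_of_nonneg_left hkey (inv_nonneg.2 hZpos.le)


/-- **Specialisation to the pinned chain.** If a state of the `N`-site chain is the Gibbs state
at temperature `T > 0` tilted by a measurable `φ` with `e^φ ∈ L¹` and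
`(φ - φ∘Θ)² ∈ L¹` of the tilted state, then its snapshot divergence is at most
`∫ (φ - φ∘Θ)² d(tilted state)`. [folklore] -/
theorem klDiv_flip_gibbs_tilted_le {ω₂ lam β : ℝ} (hω : 0 < ω₂) (hl : 0 ≤ lam) (hβ : 0 ≤ β)
    (γ : ℝ) (N : ℕ) {T : ℝ} (hT : 0 < T) {φ : PhaseSpace N → ℝ} (hφm : Measurable φ)
    (hexp : Integrable (fun x => exp (φ x)) ((pinnedChain ω₂ lam β γ).gibbsMeasure N T))
    (h2 : Integrable (fun x => (φ x - φ (x.1, -x.2)) ^ 2)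
      (((pinnedChain ω₂ lam β γ).gibbsMeasure N T).tilted φ)) :
    klDiv (((pinnedChain ω₂ lam β γ).gibbsMeasure N T).tilted φ)
        ((((pinnedChain ω₂ lam β γ).gibbsMeasure N T).tilted φ).map
          (fun x : PhaseSpace N => (x.1, -x.2))) ≤
      ENNReal.ofReal (∫ x, (φ x - φ (x.1, -x.2)) ^ 2
        ∂(((pinnedChain ω₂ lam β γ).gibbsMeasure N T).tilted φ)) := by
  haveI := pinnedChain_isProbabilityMeasure_gibbsMeasure hω hl hβ γ N hT
  exact klDiv_flip_tilted_le_integral_sq (gibbsMeasure_map_flip (pinnedChain ω₂ lam β γ) N T)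
    hφm hexp h2

end Summit.AtomisticToContinuum.FouriersLaw.Theorems.ExtensiveSnapshotIrreversibility.Negative
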